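import Mathlib
import HarnessLib
import Summits.ValiantsHypothesis.ValiantsHypothesis.Theses.MonotoneRestoration
import Literature.Computability.AlgebraicComplexity.ArithCircuit
import Literature.Computability.AlgebraicComplexity.ArithCircuitProofs
import Literature.Computability.AlgebraicComplexity.MonotoneStructure
import Literature.Computability.AlgebraicComplexity.PermanentIrreducible
import Literature.ModelTheory.FiniteModelTheory.CkEquiv
import Summits.ValiantsHypothesis.ValiantsHypothesis.Theorems.MonotoneRestorationMonotoneRestorationQPCosetCount
import Summits.ValiantsHypothesis.ValiantsHypothesis.Theorems.MonotoneRestorationMonotoneRestorationQPSymmetricLB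
import Summits.ValiantsHypothesis.ValiantsHypothesis.Theorems.MonotoneRestorationMonotoneRestorationQPSupportSymmetrisation
import Summits.ValiantsHypothesis.ValiantsHypothesis.Theorems.MonotoneRestorationMonotoneRestorationQPSparseRegime
import Summits.ValiantsHypothesis.ValiantsHypothesis.Theorems.MonotoneRestorationMonotoneRestorationQPBeta
import Literature.Computability.AlgebraicComplexity.SymmetricArithCircuit
import Literature.Computability.AlgebraicComplexity.DawarWilsenach2025Proofs
import Literature.GroupTheory.PermutationGroups.SmallIndexSubgroups
import Summits.ValiantsHypothesis.ValiantsHypothesis.Theorems.MonotoneRestorationQP.Negative.LoadBearing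
import Summits.ValiantsHypothesis.ValiantsHypothesis.Theorems.MonotoneRestorationMonotoneRestorationQPPermSupportCount
import Summits.ValiantsHypothesis.ValiantsHypothesis.Theorems.MonotoneRestorationMonotoneRestorationQPMonotoneComputationOfComplexity

/-! TTRL-lite variant V19020 of stmt-ValiantsHypothesis-15886 -/

set_option linter.dupNamespace false

namespace Summit.ValiantsHypothesis.ValiantsHypothesis.Theorems

open Summit.ValiantsHypothesis.ValiantsHypothesis.Theses.MonotoneRestoration
open Literature.Computability.AlgebraicComplexity

/-- TTRL-lite variant V19020 (`small_case`: `complexity f = 0`) of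
`stub_monotoneComputation_of_complexity` (`stmt-ValiantsHypothesis-15886`): if
`complexity f = 0` then `f` has a Jerrum–Snir monotone computation of size `0`. Immediate from the
tree's `stub_monotoneComputation_of_complexity` (size `≤ 3 · complexity f = 0`).
[cite: JerrumSnir1982, §2.2] -/
theorem stub_monotoneComputation_of_complexity_var19020 :
    ∀ (σ : Type) (f : MvPolynomial σ NNReal), complexity f = 0 →
      ∃ P : ArithCircuit NNReal σ,
        Literature.Barriers.ValiantsHypothesis.IsMonotoneComputation P f ∧ P.size = 0 := by
  intro σ f hf
  obtain ⟨P, hP, hs⟩ := stub_monotoneComputation_of_complexity f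
  exact ⟨P, hP, by omega⟩

end Summit.ValiantsHypothesis.ValiantsHypothesis.Theorems
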